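import Summits.BirchSwinnertonDyer.BirchSwinnertonDyer.Theorems.KolyvaginDepthDoorMSymbolCert1147a1
import HarnessLib

/-!
# Route `KolyvaginDepthDoor`, crux `KolyvaginDepthSupplyKN` (stmt-BirchSwinnertonDyer-22820) —
# DEPTH TABLE v30, DATA of `1147a1`, part 3b: the pool equations `3750 ≤ k < 6080` hold for `φ` (kernel checks)

Helper file of the lead prover of line `levelone` (kdd-p1 g35; `--supports stmt-BirchSwinnertonDyer-22820 --as helper`);
MACHINE-WRITTEN DATA + `decide` (generator `work/py/genq_lean.py`, kit 1′ `…MSymbolCertCosetsC`). Half 2 of part 3 of the check of `…MSymbolCert1147a1` (`φ` satisfies the pool equations `3750 ≤ k < 6080`; split for the elaboration budget). It closes nothing and BSD is NOT proved by it.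

References: [CremonaAlgorithms1997] §2.2–2.5, §2.8, Table 1 (1147a1); [PopaZagier2017] §4 (13); [Kim2022StructureSelmer] §1.4.3;
[MazurTateTeitelbaum1986Invent] §I.8.
-/

set_option linter.dupNamespace false
-- the packed numerals are long literals
set_option linter.style.longLine false

noncomputable section

open scoped MatrixGroups ModularForm
open CongruenceSubgroup
open Literature.NumberTheory.EllipticCurves Literature.NumberTheory.EllipticCurves.ModularForms
open Literature.NumberTheory.Automorphic.PopaZagier (coeff12 coeff12M coeff coeffN)
open Summit.BirchSwinnertonDyer.BirchSwinnertonDyer.Rank2Observatory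
open Summit.BirchSwinnertonDyer.BirchSwinnertonDyer.Rank1Residual (IntModel.frobeniusTrace_eq IntModel.minimalDiscriminantInt_eq)
open Summit.BirchSwinnertonDyer.BirchSwinnertonDyer.Theorems.KolyvaginDepthDoor.MSymbolCert.Cert389a1
  (H3 H3fin support_subset_H3fin H3fin_det H3mat_nodup H3_det H3_coeff eval_map eval_append)

namespace Summit.BirchSwinnertonDyer.BirchSwinnertonDyer.Theorems.KolyvaginDepthDoor.MSymbolCert.Cert1147a1

/-! ## §1 Pool equations `3750 ≤ k < 6080` -/

set_option maxHeartbeats 4000000 in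
/-- **Certificate part 3b**: the pool equations `3750 ≤ k < 6080` vanish on `φ` (chunked kernel checks). [folklore] -/
theorem cert1147a1_poolRows1 : ∀ k, 3750 ≤ k → k < 6080 → evalInt phi1147a1 (gen1147a1 k) = 0 := by
  have hq0 : (List.range' 3750 750).all (fun k => evalInt phi1147a1 (gen1147a1 k) == 0) = true := by decide +kernel
  have hq1 : (List.range' 4500 750).all (fun k => evalInt phi1147a1 (gen1147a1 k) == 0) = true := by decide +kernel
  have hq2 : (List.range' 5250 750).all (fun k => evalInt phi1147a1 (gen1147a1 k) == 0) = true := by decide +kernel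
  have hq3 : (List.range' 6000 80).all (fun k => evalInt phi1147a1 (gen1147a1 k) == 0) = true := by decide +kernel
  intro k _hk1 hk2
  by_cases c0 : k < 4500
  · exact evalInt_chunk hq0 k (by omega) (by omega)
  by_cases c1 : k < 5250
  · exact evalInt_chunk hq1 k (by omega) (by omega)
  by_cases c2 : k < 6000
  · exact evalInt_chunk hq2 k (by omega) (by omega)
  exact evalInt_chunk hq3 k (by omega) (by omega)

end Summit.BirchSwinnertonDyer.BirchSwinnertonDyer.Theorems.KolyvaginDepthDoor.MSymbolCert.Cert1147a1

end
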